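import Summits.BirchSwinnertonDyer.BirchSwinnertonDyer.Theorems.PrintCf2RubinValueTwoColemanCoinvariantCharTraceEllipticUnitsTowerDataOffsetLevelEllipticMoment
import Literature.NumberTheory.NumberFields.RayClassFieldTwoVariableFrameGenerator
import HarnessLib

/-!
# Brick (c) at `p = 2`: THE (c)-CAPSTONE WITH ITS COLEMAN FRAME DISCHARGED — for EVERY imaginary quadratic `K` of ODD class number with
# `2 = v·v̄` split (degree one) and every conductor `𝔤₀` prime to `2` with `w_{𝔤₀} = 1`, a frame (`α`, `f`, `ν`, a local uniformiser `π` with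
# `α = π^f`, `u`, …) EXISTS in which the local (c)-identity `char_Λ((N_Σ/Col_Σ 𝒞̄_ell)_ε) = (L_ε)` holds given the analytic inputs

Cell `bsd-print-cf2`, width seat `bsd-line-cf2c-w7` g19, route C `PrintCf2RubinValueTwo`, crux of record stmt-BirchSwinnertonDyer-24033
`TwoVariableMainConjAtSplitTwoQuad` (23720 nominal), BRICK §4(c); `--supports` the crux as a helper.  THEOREMS ONLY (0 sorry, no named fact
asserted, no definition); CONDITIONAL on the published named facts `DeShalit1987.prop24_ii/iii`, `prop25_i` carried as hypotheses by the
elliptic-unit files.  Theses-free.  BSD is not proved by any of this.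

WHAT.  The capstone chain of the Coleman lane (S23 … S51, T5–T12) is framed by global/local data that earlier seats left to «the instantiator»
(memo BRICK-C-KERNEL-g18 F17): a generator `α ≡ 1 mod 𝔤₀` of `𝔭_v^f`, its `v̄`-levels `ℓ, ν`, the factorisation `f = d₀2^r`, the Frobenius-order
divisibility, AND the Lubin–Tate base `(K_v, π)` with `hαπ : α = π^f` — the last one FALSE for a positive proportion of conductors when `α` is taken
`mod 𝔤₀` (F11).  With `RayClassFieldTwoVariableFrameGenerator.exists_frameGenerator_two` (`α ≡ 1 mod 𝔤₀v̄²`: then `α = π^f` for a local uniformiser,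
class number ODD, units of `K` torsion), the level-`ν` tower lemma (`RayClassFieldTwoVariableTowerDataOffsetLevel`) and T12
(`…TowerDataOffsetLevelEllipticMoment`), THIS file proves that the frame EXISTS for every instance of the crux's hypotheses
(`IsImaginaryQuadratic K`, `¬ 2 ∣ h_K`, `v ≠ v̄` above `2` of degree one) — the remaining universally quantified data are the unramified tower `E_j`
(degrees `d₀2^j`; `LocalUnramifiedLevelUnique`), the Galois/normal-basis data `σ₀, θ`, the theta families `x` with their local Artin lifts `σ`
(II §2.4 named facts), the sign `ε`, Amice elements `g`, the two auxiliary indices `a₁, a₂` with the NUMERIC conditions of T6 (kernel theorem) and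
the ONE non-zero Coates–Wiles moment trace of T7/T10, and the divided element `L` (S43/S57 `∃!`):

* ★★★ `exists_frame_charIdeal_coinvariants_colemanImageTrace_closure_ellipticUnits_eq_span_of_ellipticUnits_moment`.

## References
* [deShalit1987] E. de Shalit, *Iwasawa theory of elliptic curves with complex multiplication* (1987), I §1.1–1.3, §3.5 (11); II §1.10, §4.9–4.10,
  §4.12, §4.14, §4.17; III §1.3–1.4, 1.10.
* [NeukirchANT1999] J. Neukirch, *Algebraic Number Theory* (1999), Ch. I §7, Ch. VI §7.
* [Serre1973CourseArithmetic] J.-P. Serre, *A Course in Arithmetic* (1973), Ch. II §3.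
-/

noncomputable section

set_option linter.dupNamespace false
set_option autoImplicit false

open Filter Topology
open scoped PowerSeries.WithPiTopology
open scoped NumberField Classical

namespace Summit.BirchSwinnertonDyer.BirchSwinnertonDyer.Theorems.PrintCf2.ColemanCoinvariantTraceEllipticUnitsFrameDischarged

open Field IsDedekindDomain IsDedekindDomain.HeightOneSpectrum ValuativeRel WithZero
open Literature.NumberTheory.NumberFields
open Literature.NumberTheory.GaloisRepresentations Literature.NumberTheory.GaloisRepresentations.IsNonarchimedeanLocalField
  Literature.NumberTheory.GaloisRepresentations.LubinTate Literature.NumberTheory.GaloisRepresentations.ArtinLocalGlobal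
open Literature.NumberTheory.EllipticCurves
open Literature.NumberTheory.ComplexMultiplication.EllipticUnits
open Literature.NumberTheory.LFunctions.AbelianDensity (artinSymbol)
open Literature.RingTheory.PowerSeries (maxEval)
open Summit.BirchSwinnertonDyer.BirchSwinnertonDyer.Theorems.PrintCf2.ColemanImage
open Summit.BirchSwinnertonDyer.BirchSwinnertonDyer.Theorems.PrintCf2.ColemanCoinvariantGalois
open Summit.BirchSwinnertonDyer.BirchSwinnertonDyer.Theorems.PrintCf2.ColemanCoinvariantArtin
open Summit.BirchSwinnertonDyer.BirchSwinnertonDyer.Theorems.PrintCf2.EllipticUnitsLocal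
open Summit.BirchSwinnertonDyer.BirchSwinnertonDyer.Theorems.PrintCf2.EllipticUnitsLocal₂
open Summit.BirchSwinnertonDyer.BirchSwinnertonDyer.Theorems.PrintCf2.ColemanCoinvariantEllipticUnits
open Summit.BirchSwinnertonDyer.BirchSwinnertonDyer.Theorems.PrintCf2.ColemanCoinvariantEllipticUnitsLiftable
open Summit.BirchSwinnertonDyer.BirchSwinnertonDyer.Theorems.PrintCf2.ColemanCoinvariantTrace
open Summit.BirchSwinnertonDyer.BirchSwinnertonDyer.Theorems.PrintCf2.ColemanCoinvariantTraceEllipticUnits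
open Summit.BirchSwinnertonDyer.BirchSwinnertonDyer.Theorems.PrintCf2.ColemanCoinvariantTraceEllipticUnitsTowerDataOffset
open Summit.BirchSwinnertonDyer.BirchSwinnertonDyer.Theorems.PrintCf2.ColemanCoinvariantTraceEllipticUnitsTowerDataOffsetIndex
open Summit.BirchSwinnertonDyer.BirchSwinnertonDyer.Theorems.PrintCf2.ColemanCoinvariantTraceEllipticUnitsTowerDataOffsetMoment

open Summit.BirchSwinnertonDyer.BirchSwinnertonDyer.Theorems.PrintCf2.ColemanCoinvariantTraceEllipticUnitsTowerDataOffsetLevelEllipticMoment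

variable {K : Type} [Field K] [NumberField K] {𝔤₀ : Ideal (𝓞 K)} {v v' : HeightOneSpectrum (𝓞 K)}

attribute [local instance] ltNormUniformSpace ltNormIsUniformAddGroup rk1 nF nE fintypeResidueField
attribute [local instance] RelNormCoherentUnits.instCommMonoid

/-- `v ∤ 𝔤₀v'^ν` for `v ∤ 𝔤₀`, `v ≠ v'`. [cite: deShalit1987, II.4.14 (p. 71)] -/
private theorem not_mul_pow_le₃₀ (hv : ¬ 𝔤₀ ≤ v.asIdeal) (hvv' : v' ≠ v) (n : ℕ) : ¬ 𝔤₀ * v'.asIdeal ^ n ≤ v.asIdeal := by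
  intro h
  rcases (v.isPrime.mul_le).mp h with h1 | h2
  · exact hv h1
  · rcases n with _ | n
    · rw [pow_zero, Ideal.one_eq_top, top_le_iff] at h2
      exact v.isPrime.ne_top h2
    · exact hvv' (HeightOneSpectrum.ext ((v'.isMaximal.eq_of_le v.isPrime.ne_top ((Ideal.IsPrime.pow_le_iff (hP := v.isPrime)
        (Nat.succ_ne_zero n)).mp h2))))

section Capstone

attribute [local instance] isAdicComplete_maximalIdeal_powerSeries_integer

variable [NumberField.IsTotallyComplex K]
  (h24iii : DeShalit1987.prop24_iii_unit) (h25 : DeShalit1987.prop25_i_normRelation) (h24ii : DeShalit1987.prop24_ii_galoisAction)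

include h24iii h25 h24ii in
/-- ★★★ **THE (c)-CAPSTONE WITH ITS COLEMAN FRAME DISCHARGED.**  For `K` imaginary quadratic of ODD class number, `v ≠ v̄` above `2` with `v̄` of
degree one (`#𝓞/v̄ = 2`, `2 ∈ v̄ ∖ v̄²`) and `K_v` dyadic with `q = 2`, `2` a uniformiser (degree one at `v`), and a conductor `𝔤₀ ≠ 0` prime to `v, v̄`
with `w_{𝔤₀} = 1`: THERE EXIST a local uniformiser `π` of `K_v`, a generator `α` of `𝔭_v^f` with `α ≡ 1 mod 𝔤₀`, `α ∉ 𝔭_w (w ≠ v)`, **`α = π^f` in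
`K_v`**, its `v̄`-levels `ℓ = ν ≥ 2`, the factorisation `f = d₀2^r` (`d₀` odd) with `f ∣ ord Frob_v(K(𝔤₀v̄^ν))`, and a unit `u` with `π = 2u`,
`π² ∣ π − 2`, SUCH THAT for every unramified tower `E_j` of degrees `d₀2^j` with Galois/normal-basis data, every family of theta values `x` with
local Artin lifts `σ` of the liftable indices of `𝔤 = 𝔤₀v̄^ν`, every sign `ε`, Amice elements `g`, auxiliary indices `a₁, a₂` satisfying the NUMERIC
conditions of T6 (`χ_π(σ̃_{a₁}) = γ = 1 + π²w`, `π² ∣ N a₁ − 1`, `N a₁ ≠ γ^m`, `N a₂ = χ_π(σ̃_{a₂})^m`, `χ ≠ ±1`), ONE non-zero Galois trace of a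
Coates–Wiles moment of `e(𝔞₁)` at a level/weight of parity `ε`, and the divided element `L`: **`char_Λ((N_Σ/Col_Σ 𝒞̄_ell)_ε) = (L)`**.
(`exists_frameGenerator_two` ∘ T12.) [cite: deShalit1987, I §1.1–1.3, §3.5 (11); II §1.10, §2.4 (ii), §4.9–4.10, §4.12 (29)–(33), §4.14, §4.17;
III §1.3, §1.4 (5), Cor. 1.5, Lemma 1.10 (17)] [cite: NeukirchANT1999, Ch. I §7, Ch. VI §7 Thm. (7.1)] [cite: Serre1973CourseArithmetic, Ch. II §3.3] -/
theorem exists_frame_charIdeal_coinvariants_colemanImageTrace_closure_ellipticUnits_eq_span_of_ellipticUnits_moment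
    (hK : IsImaginaryQuadratic K) (ιK : K →+* ℂ)
    (h𝔤0 : 𝔤₀ ≠ ⊥) (hv : ¬ 𝔤₀ ≤ v.asIdeal) (hv' : ¬ 𝔤₀ ≤ v'.asIdeal) (hvv' : v' ≠ v)
    (hw𝔤 : ∀ u : (𝓞 K)ˣ, (u : 𝓞 K) - 1 ∈ 𝔤₀ → u = 1)
    {p : ℕ} [hp : Fact p.Prime] (hdeg1 : Nat.card (𝓞 K ⧸ v'.asIdeal) = p) (hpv' : (p : 𝓞 K) ∈ v'.asIdeal) (hpv'2 : (p : 𝓞 K) ∉ v'.asIdeal ^ 2)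
    [CharZero (v.adicCompletion K)]
    {σ₀ : absoluteGaloisGroup (v.adicCompletion K)} (hσ₀ : IsAbsArithFrob σ₀) (hq : residueFieldCard (v.adicCompletion K) = 2)
    [IsAdicComplete (Ideal.span {(p : 𝒪[v.adicCompletion K])}) 𝒪[v.adicCompletion K]]
    (hI : Ideal.span {(p : 𝒪[v.adicCompletion K])} ≠ ⊤)
    (hN : DenseRange (Nat.cast : ℕ → 𝒪[v.adicCompletion K]))
    (hp2 : p = 2) (hcl : ¬ 2 ∣ NumberField.classNumber K)
    (h2 : (valuation (v.adicCompletion K)).IsUniformizer ((((2 : ℕ) : 𝒪[v.adicCompletion K]) : v.adicCompletion K))) :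
    ∃ (π : 𝒪[v.adicCompletion K]) (hπ : (valuation (v.adicCompletion K)).IsUniformizer (π : v.adicCompletion K))
      (α : 𝓞 K) (hα0 : α ≠ 0) (hα𝔤 : α - 1 ∈ 𝔤₀) (hαw : ∀ w : HeightOneSpectrum (𝓞 K), w ≠ v → α ∉ w.asIdeal)
      (f : ℕ) (hαf : Ideal.span {α} = v.asIdeal ^ f) (hαπ : ((α : K) : v.adicCompletion K) = (π : v.adicCompletion K) ^ f)
      (ℓ ν : ℕ) (hℓ : 1 ≤ ℓ) (hαℓ : v'.intValuation (α - 1) = exp (-(ℓ : ℤ)))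
      (ha2 : 2 ≤ ν + 1 ∨ p ≠ 2) (hαa : v'.intValuation (α ^ p - 1) = exp (-((ν + 1 : ℕ) : ℤ)))
      (d₀ r : ℕ) (hd : d₀.Coprime p) (hf : f = d₀ * p ^ r) (hfo : f ∣ orderOf (galFrob K (rayClassField K (𝔤₀ * v'.asIdeal ^ ν)) v))
      (u : (LTCoeff (v.adicCompletion K))ˣ) (hu : LTCoeff.of (v.adicCompletion K) π = residueFieldCard (v.adicCompletion K) * u)
      (_ : NeZero d₀)
      (_ : ∃ m₁ : ℕ, LTCoeff.of (v.adicCompletion K) π ^ 2 ∣ LTCoeff.of (v.adicCompletion K) π - m₁),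
    ∀ (E : ℕ → IntermediateField (v.adicCompletion K) (AlgebraicClosure (v.adicCompletion K)))
      [∀ j, FiniteDimensional (v.adicCompletion K) (E j)] [∀ j, Normal (v.adicCompletion K) (E j)] [∀ j, IsGalois (v.adicCompletion K) (E j)]
      (hmono : Monotone E) (hE : ∀ j, E j ≤ maxUnramified (v.adicCompletion K)) (hdeg : ∀ j, Module.finrank (v.adicCompletion K) (E j) = d₀ * p ^ j)
      (γ w : 𝒪[v.adicCompletion K]ˣ) (hγ : (γ : 𝒪[v.adicCompletion K]) = 1 + π ^ 2 * w)
      [IsAdicComplete (Ideal.span {intBase (v.adicCompletion K) (LTCoeff.of (v.adicCompletion K) π)}) (PowerSeries 𝒪[v.adicCompletion K])]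
      {θ : ∀ j, unitBall (E j)} (hθ : ∀ j, IsIntegralNormalGen (E j) (θ j))
      (hcoh : ∀ j, unitBallTrace (hmono (Nat.le_succ j)) (θ (j + 1)) = θ j)
      (hud : ∀ j, (u : LTCoeff (v.adicCompletion K)) ^ Module.finrank (v.adicCompletion K) (E j) ≠ 1)
      (x : ∀ a : {𝔞 : Ideal (𝓞 K) // IsLocArtinLiftable (𝔤₀ * v'.asIdeal ^ ν) v v' 𝔞}, ∀ i k : ℕ,
        rayClassField K (𝔤₀ * v'.asIdeal ^ ν * v'.asIdeal ^ (i + 1) * v.asIdeal ^ (k + 1)))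
      (hx : ∀ a, ∀ i k : ℕ, IsThetaValueOne ιK (𝔤₀ * v'.asIdeal ^ ν * v'.asIdeal ^ (i + 1) * v.asIdeal ^ (k + 1)) (a.1 : Ideal (𝓞 K))
        (algClosureEmb ιK ((x a i k : rayClassField K (𝔤₀ * v'.asIdeal ^ ν * v'.asIdeal ^ (i + 1) * v.asIdeal ^ (k + 1))) : AlgebraicClosure K)))
      (σ : {𝔞 : Ideal (𝓞 K) // IsLocArtinLiftable (𝔤₀ * v'.asIdeal ^ ν) v v' 𝔞} → absoluteGaloisGroup (v.adicCompletion K))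
      (hσ : ∀ a, ∀ i k : ℕ, absRestrictNormalHom (rayClassField K (𝔤₀ * v'.asIdeal ^ ν * v'.asIdeal ^ (i + 1) * v.asIdeal ^ (k + 1)))
          (absGaloisRestrict K (v.adicCompletion K) (σ a)) =
        artinSymbol (galFrob K (rayClassField K (𝔤₀ * v'.asIdeal ^ ν * v'.asIdeal ^ (i + 1) * v.asIdeal ^ (k + 1)))) (a.1 : Ideal (𝓞 K)))
      (ε : PowerSeries (PowerSeries 𝒪[v.adicCompletion K]))
      (g : {𝔞 : Ideal (𝓞 K) // IsLocArtinLiftable (𝔤₀ * v'.asIdeal ^ ν) v v' 𝔞} → (PowerSeries 𝒪[v.adicCompletion K])ˣ)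
      (hε : ε * ε = 1)
    (a₁ a₂ : {𝔞 : Ideal (𝓞 K) // IsLocArtinLiftable (𝔤₀ * v'.asIdeal ^ ν) v v' 𝔞}) (hv₁ : lubinTateChar hπ (σ a₁) = γ)
    (hn₁ : ((Ideal.absNorm (a₁.1 : Ideal (𝓞 K)) : ℕ) : PowerSeries 𝒪[v.adicCompletion K]) * ((g a₁)⁻¹ : (PowerSeries 𝒪[v.adicCompletion K])ˣ) - 1 ∈
      IsLocalRing.maximalIdeal (PowerSeries 𝒪[v.adicCompletion K]))
    (hg₁ : PowerSeries.constantCoeff (g a₁ : PowerSeries 𝒪[v.adicCompletion K]) = 1)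
    (hg₂ : PowerSeries.constantCoeff (g a₂ : PowerSeries 𝒪[v.adicCompletion K]) = 1)
    (hn₁π : π ^ 2 ∣ ((Ideal.absNorm (a₁.1 : Ideal (𝓞 K)) : ℕ) : 𝒪[v.adicCompletion K]) - 1)
    {m : ℕ} (hne : ((Ideal.absNorm (a₁.1 : Ideal (𝓞 K)) : ℕ) : 𝒪[v.adicCompletion K]) ≠ (γ : 𝒪[v.adicCompletion K]) ^ m)
    (hn₂ : ((Ideal.absNorm (a₂.1 : Ideal (𝓞 K)) : ℕ) : 𝒪[v.adicCompletion K]) = (lubinTateChar hπ (σ a₂) : 𝒪[v.adicCompletion K]) ^ m)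
    (hv₂ : lubinTateChar hπ (σ a₂) ≠ 1) (hv₂' : lubinTateChar hπ (σ a₂) ≠ -1)
    (mm kk : ℕ) [IsAdicComplete (Ideal.span {algebraMap (LTCoeff (v.adicCompletion K)) (unitBall (E mm)) (LTCoeff.of (v.adicCompletion K) π)})
      (unitBall (E mm))]
    (hεk : PowerSeries.map ((algebraMap 𝒪[v.adicCompletion K] (unitBall (E mm))).comp
      (PowerSeries.constantCoeff (R := 𝒪[v.adicCompletion K]))) ε = (-1) ^ (kk + 1))
    (hmom : ∑ τ : E mm ≃ₐ[v.adicCompletion K] E mm, unitBallEquiv (E mm) τ (coordMoment hπ (E mm) u kk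
      (relUnitCoordTwo hπ (E mm) hq (hE mm) hσ₀ u hu
        (extendDown hπ E hmono (r + 1) (ellipticUnitsLocal₂ h24iii h25 hK ιK
                    (mul_ne_zero h𝔤0 (pow_ne_zero ν v'.ne_bot))
                    (not_mul_pow_le₃₀ hv hvv' ν) hvv'
                    (hw_of_towerData hw𝔤) hπ
                    (towerData_hα0 (p := p) hα0)
                    (towerData_hα𝔪 hv' hp.out hpv' hpv'2 hα𝔤 ha2 hαa)
                    (towerData_hαw (p := p) hαw)
                    (towerData_hαπ (p := p) hαπ) (fun i ↦ E (i + (r + 1)))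
                  (fun i ↦ hE (i + (r + 1)))
                      (towerDataOffset_hdegE hf E hE hdeg) a₁.2.1 a₁.2.2.1 (x a₁) (hx a₁)) mm))) ≠ 0)
    (L : PowerSeries (PowerSeries 𝒪[v.adicCompletion K]))
    (hL : ∀ b : {𝔞 : Ideal (𝓞 K) // IsLocArtinLiftable (𝔤₀ * v'.asIdeal ^ ν) v v' 𝔞}, colemanDeltaCoinvFun hπ hq (intBase (v.adicCompletion K)) u hu γ (eq_zero_of_C_pi_mul_eq_zero_integer hπ) w hγ ε
        (indexTraceₗ hπ hq u hu γ (colemanImage hd hπ E hmono hE hdeg hσ₀ hq u hu γ hθ hcoh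
          (closure_unitsGen_subset_principalCoherentFamilies hπ E hmono
            (fun b ↦ ellipticUnitsPrincipal₂ h24iii h25 hK ιK
                (mul_ne_zero h𝔤0 (pow_ne_zero ν v'.ne_bot))
                (not_mul_pow_le₃₀ hv hvv' ν) hvv'
                (hw_of_towerData hw𝔤) hπ
                (towerData_hα0 (p := p) hα0)
                (towerData_hα𝔪 hv' hp.out hpv' hpv'2 hα𝔤 ha2 hαa)
                (towerData_hαw (p := p) hαw)
                (towerData_hαπ (p := p) hαπ) E hmono (r + 1) (fun i ↦ hE (i + (r + 1)))
                (towerDataOffset_hdegE hf E hE hdeg)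
              b.2.1 b.2.2.1 (x b) (hx b))
            (fun b ↦ ellipticUnitsPrincipal₂_mem_principalCoherentFamilies h24iii h25 hK ιK
                (mul_ne_zero h𝔤0 (pow_ne_zero ν v'.ne_bot))
                (not_mul_pow_le₃₀ hv hvv' ν) hvv'
                (hw_of_towerData hw𝔤) hπ
                (towerData_hα0 (p := p) hα0)
                (towerData_hα𝔪 hv' hp.out hpv' hpv'2 hα𝔤 ha2 hαa)
                (towerData_hαw (p := p) hαw)
                (towerData_hαπ (p := p) hαπ) E hmono (r + 1)
              (fun i ↦ hE (i + (r + 1)))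
                  (towerDataOffset_hdegE hf E hE hdeg) b.2.1 b.2.2.1 (fun i ↦
                  (towerDataOffset_hinert_of_level h𝔤0 hv hv' hvv' hw𝔤 hp.out hpv' hpv'2 hπ hα0 hα𝔤 hαf hℓ hαℓ ha2 hαa hfo E hE (r + 1) (finrank_add_offset_eq E hf hdeg)) (i + 1))
                  (towerDataOffset_hcount h𝔤0 hv' hvv' hw𝔤 hp.out hdeg1 hpv' hpv'2 E hdeg) (x b) (hx b))
            (mem_closure_unitsGen hπ E _ b)).1)) =
      (colemanDeltaCoinvFun hπ hq (intBase (v.adicCompletion K)) u hu γ (eq_zero_of_C_pi_mul_eq_zero_integer hπ) w hγ ε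
          (unitTwistₗ hπ hq (intBase (v.adicCompletion K)) u hu γ (lubinTateChar hπ (σ b)) (TActModule.ofPS _ _ 1)) *
          PowerSeries.C (g b : PowerSeries 𝒪[v.adicCompletion K]) - PowerSeries.C ((Ideal.absNorm (b.1 : Ideal (𝓞 K)) : ℕ) : PowerSeries 𝒪[v.adicCompletion K])) * L),
        Module.charIdeal (PowerSeries (PowerSeries 𝒪[v.adicCompletion K]))
        (↥(unitsImageTrace hd hπ E hmono hE hdeg hσ₀ hq u hu γ hθ hcoh hI hud) ⧸
          colemanCoinvRel hπ hq (intBase (v.adicCompletion K)) u hu γ ε (unitsImageTrace hd hπ E hmono hE hdeg hσ₀ hq u hu γ hθ hcoh hI hud)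
            (fun _ hG => unitTwistₗ_mem_unitsImageTrace hd hπ E hmono hE hdeg hσ₀ hq u hu γ hθ hcoh hI hud (-1) hG)
            (colemanImageTrace hd hπ E hmono hE hdeg hσ₀ hq u hu γ hθ hcoh hN
              (closure (Submonoid.closure
                (Set.range (fun b ↦ ellipticUnitsPrincipal₂ h24iii h25 hK ιK
                    (mul_ne_zero h𝔤0 (pow_ne_zero ν v'.ne_bot))
                    (not_mul_pow_le₃₀ hv hvv' ν) hvv'
                    (hw_of_towerData hw𝔤) hπ
                    (towerData_hα0 (p := p) hα0)
                    (towerData_hα𝔪 hv' hp.out hpv' hpv'2 hα𝔤 ha2 hαa)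
                    (towerData_hαw (p := p) hαw)
                    (towerData_hαπ (p := p) hαπ) E hmono (r + 1) (fun i ↦ hE (i + (r + 1)))
                  (towerDataOffset_hdegE hf E hE hdeg) b.2.1 b.2.2.1 (x b) (hx b)) ∪
                  Set.range fun b ↦ fun j ↦ (ellipticUnitsPrincipal₂ h24iii h25 hK ιK
                      (mul_ne_zero h𝔤0 (pow_ne_zero ν v'.ne_bot))
                      (not_mul_pow_le₃₀ hv hvv' ν) hvv'
                      (hw_of_towerData hw𝔤) hπ
                      (towerData_hα0 (p := p) hα0)
                      (towerData_hα𝔪 hv' hp.out hpv' hpv'2 hα𝔤 ha2 hαa)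
                      (towerData_hαw (p := p) hαw)
                      (towerData_hαπ (p := p) hαπ) E hmono (r + 1)
                    (fun i ↦ hE (i + (r + 1))) (towerDataOffset_hdegE hf E hE hdeg) b.2.1 b.2.2.1 (x b) (hx b) j).inv hπ (E j)) :
                Set (∀ j, RelNormCoherentUnits hπ (E j))))
              isClosed_closure
              (closure_unitsGen_subset_principalCoherentFamilies hπ E hmono _
                (fun b ↦ ellipticUnitsPrincipal₂_mem_principalCoherentFamilies h24iii h25 hK ιK
                    (mul_ne_zero h𝔤0 (pow_ne_zero ν v'.ne_bot))
                    (not_mul_pow_le₃₀ hv hvv' ν) hvv'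
                    (hw_of_towerData hw𝔤) hπ
                    (towerData_hα0 (p := p) hα0)
                    (towerData_hα𝔪 hv' hp.out hpv' hpv'2 hα𝔤 ha2 hαa)
                    (towerData_hαw (p := p) hαw)
                    (towerData_hαπ (p := p) hαπ) E hmono (r + 1)
                  (fun i ↦ hE (i + (r + 1)))
                      (towerDataOffset_hdegE hf E hE hdeg) b.2.1 b.2.2.1 (fun i ↦
                      (towerDataOffset_hinert_of_level h𝔤0 hv hv' hvv' hw𝔤 hp.out hpv' hpv'2 hπ hα0 hα𝔤 hαf hℓ hαℓ ha2 hαa hfo E hE (r + 1) (finrank_add_offset_eq E hf hdeg)) (i + 1))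
                      (towerDataOffset_hcount h𝔤0 hv' hvv' hw𝔤 hp.out hdeg1 hpv' hpv'2 E hdeg) (x b) (hx b)))
              (one_mem_closure_unitsGen hπ E _) (mul_mem_closure_unitsGen hπ E _) (inv_mem_closure_unitsGen hπ E _)
              (galAct_mem_closure_unitsGen hπ E _ (galAct_mem_closure_unitsGen_of_mul_rule hπ E hmono _ σ
                (happrox_of_isLocArtinLiftable
                    (mul_ne_zero h𝔤0 (pow_ne_zero ν v'.ne_bot))
                    (not_mul_pow_le₃₀ hv hvv' ν) hvv'
                    (hw_of_towerData hw𝔤) hπ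
                    (towerData_hα0 (p := p) hα0)
                    (towerData_hα𝔪 hv' hp.out hpv' hpv'2 hα𝔤 ha2 hαa)
                    (towerData_hαw (p := p) hαw)
                    (towerData_hαπ (p := p) hαπ) E hmono hE (r + 1)
                    (towerDataOffset_hdegE hf E hE hdeg)
                    (towerDataOffset_hinert_of_level h𝔤0 hv hv' hvv' hw𝔤 hp.out hpv' hpv'2 hπ hα0 hα𝔤 hαf hℓ hαℓ ha2 hαa hfo E hE (r + 1) (finrank_add_offset_eq E hf hdeg))
                    (towerDataOffset_hcount h𝔤0 hv' hvv' hw𝔤 hp.out hdeg1 hpv' hpv'2 E hdeg) σ hσ)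
                (fun a b ↦ ⟨a.1 * b.1, a.2.mul b.2⟩)
                (fun b ↦ Ideal.absNorm (b.1 : Ideal (𝓞 K)))
                (hrule_ellipticUnitsPrincipal₂ h24iii h25 hK ιK
                    (mul_ne_zero h𝔤0 (pow_ne_zero ν v'.ne_bot))
                    (not_mul_pow_le₃₀ hv hvv' ν) hvv'
                    (hw_of_towerData hw𝔤) hπ
                    (towerData_hα0 (p := p) hα0)
                    (towerData_hα𝔪 hv' hp.out hpv' hpv'2 hα𝔤 ha2 hαa)
                    (towerData_hαw (p := p) hαw)
                    (towerData_hαπ (p := p) hαπ) E hmono (r + 1) (fun i ↦ hE (i + (r + 1)))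
                    (towerDataOffset_hdegE hf E hE hdeg) h24ii
                  Subtype.val (fun a b ↦ ⟨a.1 * b.1, a.2.mul b.2⟩) (fun _ _ ↦ rfl) (fun a ↦ a.2.1) (fun a ↦ a.2.2.1) x hx σ hσ))))) =
      Ideal.span {L} := by
  have hfin : ∀ uu : (𝓞 K)ˣ, IsOfFinOrder uu :=
    isOfFinOrder_units_of_rank_eq_zero (rank_eq_zero_of_finrank_eq_two hK.1)
  have hdeg1' : Nat.card (𝓞 K ⧸ v'.asIdeal) = 2 := by rw [hdeg1, hp2]
  have hpv'' : (2 : 𝓞 K) ∈ v'.asIdeal := by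
    have h := hpv'
    rw [hp2] at h
    exact_mod_cast h
  have hpv'2' : (2 : 𝓞 K) ∉ v'.asIdeal ^ 2 := by
    have h := hpv'2
    rw [hp2] at h
    exact_mod_cast h
  have hgen := exists_frameGenerator_two (𝔤₀ := 𝔤₀) h𝔤0 hv hvv' hdeg1' hpv'' hpv'2' hcl hfin hq h2
  obtain ⟨α, f, ℓ, π, hπ, hα0, hα𝔤, hαw, hαf, hαπ, hf1, hℓ2, hαℓ, hαa2, hfo, hs2, hdvd⟩ := hgen
  obtain ⟨s, hsu, hs⟩ := hs2
  have hfac := Nat.exists_eq_two_pow_mul_odd (n := f) (Nat.one_le_iff_ne_zero.mp hf1)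
  obtain ⟨r, d₀, hd₀, hfeq⟩ := hfac
  haveI hd0 : NeZero d₀ := NeZero.of_pos hd₀.pos
  have hd : d₀.Coprime p := by rw [hp2]; exact Nat.coprime_two_right.mpr hd₀
  have hf : f = d₀ * p ^ r := by rw [hp2, hfeq, mul_comm]
  have hℓ : 1 ≤ ℓ := (show 1 < ℓ from hℓ2).le
  have ha2 : 2 ≤ ℓ + 1 ∨ p ≠ 2 := Or.inl (Nat.le_succ_of_le hℓ2)
  have hαa : v'.intValuation (α ^ p - 1) = exp (-((ℓ + 1 : ℕ) : ℤ)) := by rw [hp2]; exact hαa2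
  -- the unit `u` with `π = 2u`, and `π ≡ 2 mod π²`
  have hπ2 : π = 2 * ((hsu.unit⁻¹ : 𝒪[v.adicCompletion K]ˣ) : 𝒪[v.adicCompletion K]) := by
    calc π = π * (s * ((hsu.unit⁻¹ : 𝒪[v.adicCompletion K]ˣ) : 𝒪[v.adicCompletion K])) := by rw [IsUnit.mul_val_inv, mul_one]
      _ = 2 * ((hsu.unit⁻¹ : 𝒪[v.adicCompletion K]ˣ) : 𝒪[v.adicCompletion K]) := by rw [← mul_assoc, ← hs]
  have hu_ex : ∃ u : (LTCoeff (v.adicCompletion K))ˣ, u = Units.map (LTCoeff.of (v.adicCompletion K)).toRingHom.toMonoidHom hsu.unit⁻¹ :=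
    ⟨_, rfl⟩
  obtain ⟨u, hu_def⟩ := hu_ex
  have hu : LTCoeff.of (v.adicCompletion K) π = residueFieldCard (v.adicCompletion K) * u := by
    rw [hq, hu_def, Units.coe_map, hπ2, map_mul]
    push_cast
    rfl
  have hm : ∃ m₁ : ℕ, LTCoeff.of (v.adicCompletion K) π ^ 2 ∣ LTCoeff.of (v.adicCompletion K) π - m₁ := by
    refine ⟨2, ?_⟩
    have h := map_dvd (LTCoeff.of (v.adicCompletion K)) hdvd
    rw [map_pow, map_sub, map_ofNat] at h
    push_cast
    exact h
  refine ⟨π, hπ, α, hα0, hα𝔤, hαw, f, hαf, hαπ, ℓ, ℓ, hℓ, hαℓ, ha2, hαa, d₀, r, hd, hf, hfo, u, hu, hd0, hm, ?_⟩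
  intro E _ _ _ hmono hE hdeg γ w hγ _ θ hθ hcoh hud x hx σ hσ ε g hε a₁ a₂ hv₁ hn₁ hg₁ hg₂ hn₁π m hne hn₂ hv₂ hv₂' mm kk _ hεk hmom L hL
  exact charIdeal_coinvariants_colemanImageTrace_closure_ellipticUnits_towerDataOffsetLevel_eq_span_of_ellipticUnits_moment h24iii h25 h24ii hK ιK
    h𝔤0 hv hv' hvv' hw𝔤 hdeg1 hpv' hpv'2 hπ hα0 hα𝔤 hαw hαf hαπ hℓ hαℓ ha2 hαa hd hf hfo E hmono hE hdeg hσ₀ hq u hu γ w hγ hθ hcoh hI hud hm hN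
    x hx σ hσ ε g hε a₁ a₂ hv₁ hn₁ hg₁ hg₂ hn₁π hne hn₂ hv₂ hv₂' mm kk hεk hmom L hL

end Capstone

end Summit.BirchSwinnertonDyer.BirchSwinnertonDyer.Theorems.PrintCf2.ColemanCoinvariantTraceEllipticUnitsFrameDischarged

end
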